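import Summits.ResolutionOfSingularities.ResolutionOfSingularities.Theorems.EquisingularLiftEquisingularLiftNatInfinitesimalFibreCharts
import Summits.ResolutionOfSingularities.ResolutionOfSingularities.Theorems.EquisingularLiftEquisingularLiftNatTransitionChartFlat
import Summits.ResolutionOfSingularities.ResolutionOfSingularities.Theorems.EquisingularLiftEquisingularLiftNatEmbeddedLiftChartLocalRing
import Mathlib.RingTheory.HopkinsLevitzki
import HarnessLib

/-!
# [OURS · L1 W4.5(b) · EL♮(3) · (T-k) · J1c brick B4 = (λ♯)] Chart-local flat lifts of `Yₙ ↪ Wₙ` to `Wₙ₊₁` at every point of `Y₀`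

Crux EL♮(3) = stmt-ResolutionOfSingularities-20148; J1 = `EmbeddedInfinitesimalLiftFact` (p596985) ⟸ `EmbeddedInfinitesimalChartLiftFact` (p603689).
Written by res-L1-w45b-stub-4 g10 (brick B4 = (λ♯) of `L/res-type-027/J1c-DESIGN-v2.md` §2; desk R5 (ii) / R11 (v) / R12′ (iii)). OURS; NOT a
statement of H. Hironaka's 2017 manuscript; AI-written, weaker than expert review. No `sorry`; standard axioms; DEF-FREE.
`--supports stmt-ResolutionOfSingularities-20148 --as helper`.

WHAT. **B4 ASSEMBLY `exists_affine_chartLift`** — the input of res-type-027's patching engine (F5/F6/F7): in the situation of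
`EmbeddedInfinitesimalLiftFact` (`w : W → Spec O` flat, special fibre `W₀`, `jn : Yₙ ↪ Wₙ` a flat closed subscheme of the level `Wₙ`
restricting to `Y₀ ↪ W₀` along the `s₀` square, `Y₀ ⊆ W₀` lci on the chart `Uz`), every point of `Y₀` has, inside any prescribed open of
`Wₙ₊₁`, an AFFINE chart `U` and an ideal `I' ≤ Γ(Wₙ₊₁, U)` with
* `Γ(Wₙ₊₁, U) ⧸ I'` flat over `O ⧸ 𝔪ⁿ⁺²` (instance-free: the ring map `(O ⧸ 𝔪ⁿ⁺² → Γ(Wₙ₊₁, U)) ≫ mk I'` is flat), and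
* the CHART CLAUSE `I'·Γ(Wₙ, t⁻¹U) = ker (Γ(Wₙ, t⁻¹U) → Γ(Yₙ, ·))` (`t` the transition) of `EmbeddedInfinitesimalChartLiftFact`.
Proof = res-L1-w45b-stub-2's B4 INPUT PACKAGE `exists_chart_weaklyRegular_lift_data` (p607654: D0/D3/D4 + B3, the chart `U` and weakly
regular generators `a'` of the ideal `K(U)` of `Yₙ` modulo `𝔪`) fed into the ring core `exists_flat_lift_sup_eq_of_isWeaklyRegular_fiber`
(p606077, (λ) of J1b) over the Artinian local base `O ⧸ 𝔪ⁿ⁺²`, whose typeclass hypothesis «the chart ring of `Yₙ`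
is flat over `O ⧸ 𝔪ⁿ⁺¹`» is D2 `moduleFlat_chart_quotient_of_isPullback` (this seat) at `isPullback_transition` (D1, p606078); the chart
clause is `map_eq_ker_of_sup_ker_eq_comap` (p606077) on the lift identity `I' ⊔ ker (t.app U) = K(U)`.
[cite: Hartshorne2010, Thm. 9.2 (b), (c)] (index only; the local-to-global form is OURS)
-/

set_option linter.dupNamespace false

noncomputable section

open CategoryTheory CategoryTheory.Limits AlgebraicGeometry TopologicalSpace
open Literature.AlgebraicGeometry.Morphisms (infinitesimalNeighbourhood)
open Literature.AlgebraicGeometry.Resolution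
open IsLocalRing RingTheory.Sequence

namespace Summit.ResolutionOfSingularities.ResolutionOfSingularities.Cruxes.EquisingularLiftNat.Sections

/-- **B4 = (λ♯): chart-local flat lifts at every point of `Y₀`.** See the module docstring. [OURS · L1 W4.5b · J1c B4] toward
`stub_elnat_embeddedInfinitesimalLiftFact`; NOT a statement of the manuscript. -/
theorem exists_affine_chartLift {O : Type} [CommRing O] [IsDomain O] [IsDiscreteValuationRing O] {k : Type} [Field k] {θ : O →+* k}
    {W : Scheme.{0}} {w : W ⟶ Spec (.of O)} [Flat w] {W₀ : Scheme.{0}} {jW : W₀ ⟶ W} {tW : W₀ ⟶ Spec (.of k)}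
    (hsq : IsPullback jW tW w (Spec.map (CommRingCat.ofHom θ))) (hθ : Function.Surjective θ)
    {n : ℕ} {θm : O ⧸ maximalIdeal O ^ (n + 1 + 1) →+* k} (hθm : θm.comp (Ideal.Quotient.mk _) = θ)
    {e : W₀ ⟶ infinitesimalNeighbourhood (maximalIdeal O) w (n + 1)}
    (he₁ : e ≫ infinitesimalNeighbourhood.ι (maximalIdeal O) w (n + 1) = jW)
    (he₂ : e ≫ infinitesimalNeighbourhood.toSpec (maximalIdeal O) w (n + 1) = tW ≫ Spec.map (CommRingCat.ofHom θm))
    {Y₀ : Scheme.{0}} {ι : Y₀ ⟶ W₀} {Yn : Scheme.{0}} {jn : Yn ⟶ infinitesimalNeighbourhood (maximalIdeal O) w n}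
    [IsClosedImmersion jn] [Flat (jn ≫ infinitesimalNeighbourhood.toSpec (maximalIdeal O) w n)]
    {s₀ : Y₀ ⟶ Yn} (hs₀ : IsPullback s₀ ι (jn ≫ infinitesimalNeighbourhood.ι (maximalIdeal O) w n) jW)
    {z : Y₀} {Uz : W₀.affineOpens} (hz : ι.base z ∈ (Uz : W₀.Opens))
    (hUz : ∃ rs : List Γ(W₀, Uz), IsWeaklyRegular Γ(W₀, Uz) rs ∧ Ideal.ofList rs = ι.ker.ideal Uz)
    (N : (infinitesimalNeighbourhood (maximalIdeal O) w (n + 1)).Opens) (hN : e.base (ι.base z) ∈ N) :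
    ∃ U : (infinitesimalNeighbourhood (maximalIdeal O) w (n + 1)).affineOpens,
      e.base (ι.base z) ∈ (U : (infinitesimalNeighbourhood (maximalIdeal O) w (n + 1)).Opens) ∧
      (U : (infinitesimalNeighbourhood (maximalIdeal O) w (n + 1)).Opens) ≤ N ∧
      ∃ I' : Ideal Γ(infinitesimalNeighbourhood (maximalIdeal O) w (n + 1), U),
        ((Ideal.Quotient.mk I').comp
          (((infinitesimalNeighbourhood.toSpec (maximalIdeal O) w (n + 1)).appLE ⊤ U le_top).hom.comp
            (Scheme.ΓSpecIso (.of (O ⧸ maximalIdeal O ^ (n + 1 + 1)))).inv.hom)).Flat ∧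
        I'.map ((infinitesimalNeighbourhood.transition (maximalIdeal O) w n).app
            (U : (infinitesimalNeighbourhood (maximalIdeal O) w (n + 1)).Opens)).hom =
          RingHom.ker (jn.app ((infinitesimalNeighbourhood.transition (maximalIdeal O) w n) ⁻¹ᵁ
            (U : (infinitesimalNeighbourhood (maximalIdeal O) w (n + 1)).Opens))).hom := by
  obtain ⟨U, hzU, hUN, as', hreg, hmem, hgen⟩ := exists_chart_weaklyRegular_lift_data hsq hθ hθm he₁ he₂ hs₀ hz hUz N hN
  refine ⟨U, hzU, hUN, Ideal.ofList as', ?_⟩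
  -- the Artinian local base `C' = O ⧸ 𝔪ⁿ⁺²` (the three `Levels.*` facts of p602708 re-derived in place: that module has no farm olean)
  have hne : ∀ k : ℕ, maximalIdeal O ^ (k + 1) ≠ ⊤ := fun k h =>
    (maximalIdeal.isMaximal O).ne_top (top_le_iff.mp (h ▸ Ideal.pow_le_self (Nat.succ_ne_zero k)))
  have hntk : ∀ k : ℕ, Nontrivial (O ⧸ maximalIdeal O ^ (k + 1)) := fun k =>
    ⟨⟨0, 1, fun h => hne k ((Ideal.eq_top_iff_one _).mpr (Ideal.Quotient.eq_zero_iff_mem.mp h.symm))⟩⟩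
  haveI hnt : Nontrivial (O ⧸ maximalIdeal O ^ (n + 1)) := hntk n
  haveI hnt' : Nontrivial (O ⧸ maximalIdeal O ^ (n + 1 + 1)) := hntk (n + 1)
  letI hloc : IsLocalRing (O ⧸ maximalIdeal O ^ (n + 1 + 1)) :=
    IsLocalRing.of_surjective' (Ideal.Quotient.mk _) Ideal.Quotient.mk_surjective
  have hmax : maximalIdeal (O ⧸ maximalIdeal O ^ (n + 1 + 1)) =
      (maximalIdeal O).map (Ideal.Quotient.mk (maximalIdeal O ^ (n + 1 + 1))) := by
    refine (IsLocalRing.eq_maximalIdeal ?_).symm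
    refine (Ideal.map_eq_top_or_isMaximal_of_surjective _ Ideal.Quotient.mk_surjective
      (maximalIdeal.isMaximal O)).resolve_left fun h => ?_
    have h1 : Ideal.Quotient.mk (maximalIdeal O ^ (n + 1 + 1)) 1 ∈
        (maximalIdeal O).map (Ideal.Quotient.mk (maximalIdeal O ^ (n + 1 + 1))) := h ▸ Submodule.mem_top
    rw [Ideal.mem_quotient_iff_mem_sup,
      sup_eq_left.mpr (Ideal.pow_le_self (Nat.succ_ne_zero _) : maximalIdeal O ^ (n + 1 + 1) ≤ maximalIdeal O)] at h1
    exact (maximalIdeal.isMaximal O).ne_top ((Ideal.eq_top_iff_one _).mpr h1)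
  haveI hart : IsArtinianRing (O ⧸ maximalIdeal O ^ (n + 1 + 1)) := by
    rw [isArtinianRing_iff_isNilpotent_maximalIdeal, hmax]
    exact ⟨n + 1 + 1, by rw [← Ideal.map_pow, Ideal.map_quotient_self, Ideal.zero_eq_bot]⟩
  -- the `C'`-algebra `A' = Γ(Wₙ₊₁, U)`
  set f₀ : O ⧸ maximalIdeal O ^ (n + 1 + 1) →+* Γ(infinitesimalNeighbourhood (maximalIdeal O) w (n + 1), U) :=
    ((infinitesimalNeighbourhood.toSpec (maximalIdeal O) w (n + 1)).appLE ⊤ U le_top).hom.comp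
      (Scheme.ΓSpecIso (.of (O ⧸ maximalIdeal O ^ (n + 1 + 1)))).inv.hom with hf₀
  letI alg : Algebra (O ⧸ maximalIdeal O ^ (n + 1 + 1)) Γ(infinitesimalNeighbourhood (maximalIdeal O) w (n + 1), U) :=
    f₀.toAlgebra
  have halg : algebraMap (O ⧸ maximalIdeal O ^ (n + 1 + 1)) Γ(infinitesimalNeighbourhood (maximalIdeal O) w (n + 1), U) = f₀ :=
    rfl
  -- D0: `A'` is flat over `C'`
  have hflatA : Module.Flat (O ⧸ maximalIdeal O ^ (n + 1 + 1)) Γ(infinitesimalNeighbourhood (maximalIdeal O) w (n + 1), U) := by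
    rw [← RingHom.flat_algebraMap_iff, halg, hf₀]
    exact RingHom.Flat.comp (RingHom.Flat.of_bijective (ConcreteCategory.bijective_of_isIso _)) (flat_appLE_toSpec U)
  -- the previous level `J = 𝔪ⁿ⁺¹ C'` and the ideal `K` of `Yₙ` in `A'`
  set J : Ideal (O ⧸ maximalIdeal O ^ (n + 1 + 1)) :=
    RingHom.ker (infinitesimalNeighbourhood.transitionRingHom (maximalIdeal O) n) with hJdef
  set K : Ideal Γ(infinitesimalNeighbourhood (maximalIdeal O) w (n + 1), U) :=
    (RingHom.ker (jn.app ((infinitesimalNeighbourhood.transition (maximalIdeal O) w n) ⁻¹ᵁ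
        (U : (infinitesimalNeighbourhood (maximalIdeal O) w (n + 1)).Opens))).hom).comap
      ((infinitesimalNeighbourhood.transition (maximalIdeal O) w n).app
        (U : (infinitesimalNeighbourhood (maximalIdeal O) w (n + 1)).Opens)).hom with hKdef
  have hJ : J ≤ maximalIdeal (O ⧸ maximalIdeal O ^ (n + 1 + 1)) :=
    IsLocalRing.le_maximalIdeal (RingHom.ker_ne_top _)
  -- `ker (t.app U) = J·A'` (D1)
  have hkerT : RingHom.ker ((infinitesimalNeighbourhood.transition (maximalIdeal O) w n).app
      (U : (infinitesimalNeighbourhood (maximalIdeal O) w (n + 1)).Opens)).hom =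
      J.map (algebraMap (O ⧸ maximalIdeal O ^ (n + 1 + 1)) Γ(infinitesimalNeighbourhood (maximalIdeal O) w (n + 1), U)) := by
    rw [ker_app_transition_eq_map (maximalIdeal O) w n U, hJdef, halg, hf₀, ← Ideal.map_map]
    congr 1
    exact (Ideal.map_symm (Scheme.ΓSpecIso (.of (O ⧸ maximalIdeal O ^ (n + 1 + 1)))).commRingCatIsoToRingEquiv).symm
  have hJK : J.map (algebraMap (O ⧸ maximalIdeal O ^ (n + 1 + 1)) Γ(infinitesimalNeighbourhood (maximalIdeal O) w (n + 1), U)) ≤ K := by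
    rw [← hkerT, hKdef]
    intro a ha
    rw [Ideal.mem_comap, RingHom.mem_ker, RingHom.mem_ker.mp ha, map_zero]
  -- D2: the chart ring of `Yₙ` is flat over `C' ⧸ J`
  have hD2 : Module.Flat ((O ⧸ maximalIdeal O ^ (n + 1 + 1)) ⧸ J)
      ((Γ(infinitesimalNeighbourhood (maximalIdeal O) w (n + 1), U) ⧸
          J.map (algebraMap (O ⧸ maximalIdeal O ^ (n + 1 + 1)) Γ(infinitesimalNeighbourhood (maximalIdeal O) w (n + 1), U))) ⧸
        K.map (Ideal.Quotient.mk (J.map (algebraMap (O ⧸ maximalIdeal O ^ (n + 1 + 1))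
          Γ(infinitesimalNeighbourhood (maximalIdeal O) w (n + 1), U))))) :=
    @moduleFlat_chart_quotient_of_isPullback _ _ _ _ _ (CommRingCat.ofHom (infinitesimalNeighbourhood.transitionRingHom (maximalIdeal O) n))
      (Ideal.Quotient.factor_surjective (Ideal.pow_le_pow_right (Nat.le_succ _))) _ _ _
      (isPullback_transition (maximalIdeal O) w n) jn inferInstance inferInstance U alg halg J hJdef K hKdef
  -- the fibre ideal `𝔪A'` in the two spellings
  have hI : (maximalIdeal (O ⧸ maximalIdeal O ^ (n + 1 + 1))).map
      (algebraMap (O ⧸ maximalIdeal O ^ (n + 1 + 1)) Γ(infinitesimalNeighbourhood (maximalIdeal O) w (n + 1), U)) =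
      ((maximalIdeal O).map (Ideal.Quotient.mk (maximalIdeal O ^ (n + 1 + 1)))).map
        (((infinitesimalNeighbourhood.toSpec (maximalIdeal O) w (n + 1)).appLE ⊤ U le_top).hom.comp
          (Scheme.ΓSpecIso (.of (O ⧸ maximalIdeal O ^ (n + 1 + 1)))).inv.hom) := by
    rw [hmax, halg]
  rw [← hI] at hreg hgen
  -- the ring core (λ)
  obtain ⟨hflat, hsup⟩ := @exists_flat_lift_sup_eq_of_isWeaklyRegular_fiber _ _ hloc hart _ _ alg hflatA J hJ K hJK hD2 as'
    hreg hmem hgen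
  refine ⟨?_, ?_⟩
  · -- flatness of `A' ⧸ I'` over `C'`
    have h := (RingHom.flat_algebraMap_iff (R := O ⧸ maximalIdeal O ^ (n + 1 + 1))
      (S := Γ(infinitesimalNeighbourhood (maximalIdeal O) w (n + 1), U) ⧸ Ideal.ofList as')).mpr hflat
    rw [← Ideal.Quotient.mk_comp_algebraMap, halg, hf₀] at h
    exact h
  · -- the chart clause
    haveI := isClosedImmersion_transition (maximalIdeal O) w n
    refine map_eq_ker_of_sup_ker_eq_comap _ ((infinitesimalNeighbourhood.transition (maximalIdeal O) w n).app_surjective _ U.2)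
      _ (Ideal.ofList as') ?_
    rw [hkerT, hsup]
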